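import Summits.RiemannHypothesis.RiemannHypothesis.Theorems.WeilColumnThetaMainTermLevelK
import HarnessLib

/-!
# PR Step 5 at level `k` with FREE norm constants (RH-FREE; weil-1 ask 2026-08-26T07:52Z)

Cell `rh-explicit`, WEIL column, seat handoff-prove-2 gen12.  `WeilColumnThetaMainTermLevelK.re_weilQuadratic_moll_oddTail_le` hard-wires
`∫‖f‖² ≤ P.A`, `∫‖f′‖² ≤ P.B` and concludes with `P.arch t₀`; for the TRUNCATED tail `f = P.TROdd R` the `H¹` norm is only
`≤ P.B + ε_R`.  This file re-threads the same proof with free `A'`, `B'`: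

  **`re_weilQuadratic_moll_oddTail_le' … (hA : ∫‖f‖² ≤ A') (hB : ∫‖f′‖² ≤ B') … :
     Re Q(f ⋆ φ_k) ≤ levelK-terms + (B'/2·e^{t₀/2}·t₀²/2 + A'·max 0 (2·Jexplicit t₀ − log 4π − γ − archC₁))`**

— the bracket is the body of `P.arch t₀` at `(A', B')` (`unfold ThetaParams.arch` at `A' = P.A`, `B' = P.B`), affine in `B'`, so
`B' = ∫‖(T_R⁻)′‖² → ∫‖(T⁻)′‖² ≤ P.B` (`WeilColumnThetaTruncatedDerivNorm`) sends it to `≤ P.arch t₀`.  Nothing here bears on RH.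
-/

noncomputable section

set_option linter.dupNamespace false

open Complex Set MeasureTheory Filter Function
open scoped Real Topology ArithmeticFunction.vonMangoldt Chebyshev

namespace Summit.RiemannHypothesis.RiemannHypothesis.Theorems.WeilColumn.ThetaMellin

open Literature.NumberTheory.LFunctions Literature.NumberTheory.LFunctions.WeilContinuous

variable {T : ℝ → ℂ}

namespace ThetaParams

variable (P : ThetaParams)

/-- **PR Step 5 at level `k` with FREE norm constants `A'`, `B'`** (for the truncated tail, whose `H¹` norm exceeds `P.B` by `ε_R`):
the same bound with `P.arch t₀` replaced by its body at `(A', B')`. [THETA-CERT-cc6 §D5–D7; THETA-ASSIGN §6; weil-1 ask 07:52Z] -/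
theorem re_weilQuadratic_moll_oddTail_le' {f : ℝ → ℂ} {E x₁ C a t₀ A' B' : ℝ} {qn : ℕ} (hP : P.Admissible qn)
    (hTc : Continuous T) (hT0 : ∀ u, x₁ < u → T u = 0) (hE : 0 ≤ E)
    (hTE : ∀ u, ‖T u‖ ≤ E * Real.exp (((P.m : ℝ) + 1 / 2) * (u - x₁)))
    (hf : ∀ u, f u = T u - T (-u)) (hf1 : ContDiff ℝ 1 f) (hfs : HasCompactSupport f) (hsupp : tsupport f ⊆ Icc (-a) a)
    (hA : ∫ x, ‖f x‖ ^ 2 ≤ A') (hB : ∫ x, ‖deriv f x‖ ^ 2 ≤ B') (ht₀ : 0 < t₀) (ht₁ : t₀ ≤ 1)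
    (hC : 0 ≤ C) (hψ : ∀ x : ℝ, 0 ≤ x → ψ x ≤ C * x) (k : ℕ) (hk : x₁ + 1 / ((k : ℝ) + 1) < 0) :
    (weilQuadratic (weilConv f (moll k))).re ≤
      2 * (E * Real.exp ((2 * P.m + 1) / ((k : ℝ) + 1))) ^ 2 / ((P.m : ℝ) + 1 / 2) * vonMangoldtSum (P.m + 1) +
        2 * (E * Real.exp ((2 * P.m + 1) / ((k : ℝ) + 1))) ^ 2 * Real.sqrt (Real.exp (-2 * (x₁ + 1 / ((k : ℝ) + 1)))) *
          (C * (Real.exp (-((P.m : ℝ) / ((P.m : ℝ) + 1))) / ((P.m : ℝ) + 1) + 1 / (P.m : ℝ) ^ 2)) +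
        (B' / 2 * Real.exp (t₀ / 2) * t₀ ^ 2 / 2 +
          A' * max 0 (2 * Jexplicit t₀ - Real.log (4 * π) - Real.eulerMascheroniConstant - archC₁)) := by
  have hm2 : 2 ≤ P.m := le_trans (by norm_num) hP.three_le
  set r : ℝ := 1 / ((k : ℝ) + 1) with hr
  set g : ℝ → ℂ := weilConv f (moll k) with hgdef
  set Tk : ℝ → ℂ := weilConv T (moll k) with hTk
  have hr0 : 0 < r := by positivity
  have hκ : 0 ≤ (P.m : ℝ) + 1 / 2 := by positivity
  have hfc : Continuous f := hf1.continuous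
  -- `g = Tk − Tk(−·)`
  have hfeq : f = fun u ↦ T u - T (-u) := funext hf
  have hg : ∀ u, g u = Tk u - Tk (-u) := fun u ↦ by
    simp only [hgdef, hTk]; rw [hfeq]; exact weilConv_oddPart_moll hTc k u
  -- the mollified tail: support edge `x₁ + r`, envelope `E e^{(2m+1)r}·e^{κ(u − (x₁+r))}`
  have hTk0 : ∀ u, x₁ + r < u → Tk u = 0 := fun u hu ↦ weilConv_moll_tail_eq_zero hT0 k hu
  have hTkE : ∀ u, u ≤ x₁ + r → ‖Tk u‖ ≤ E * Real.exp ((2 * P.m + 1) / ((k : ℝ) + 1)) *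
      Real.exp (((P.m : ℝ) + 1 / 2) * (u - (x₁ + r))) := by
    intro u _
    refine (norm_weilConv_moll_tail_le hE hκ hTE k u).trans (le_of_eq ?_)
    rw [mul_assoc, ← Real.exp_add]
    congr 2
    rw [hr]; field_simp; ring
  -- test-function facts for `g`
  have hgt : IsWeilTest g := isWeilTest_weilConv_moll hfc hfs k
  have hfz : ∀ u, a < |u| → f u = 0 := by
    intro u hu
    by_contra hne
    have hmem := hsupp (subset_tsupport _ (Function.mem_support.2 hne))
    have : |u| ≤ a := abs_le.2 ⟨by linarith [hmem.1], hmem.2⟩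
    linarith
  have hsuppg : tsupport g ⊆ Icc (-(a + 1)) (a + 1) := by
    refine closure_minimal (fun x hx ↦ ?_) isClosed_Icc
    rw [Function.mem_support] at hx
    by_contra h
    refine hx (weilConv_moll_eq_zero hfz ?_ k)
    rw [mem_Icc, not_and_or, not_le, not_le] at h
    rcases h with h | h
    · exact lt_of_lt_of_le (by linarith) (neg_le_abs x)
    · exact lt_of_lt_of_le h (le_abs_self x)
  have hodd : ∀ t, g (-t) = -g t := fun t ↦ by rw [hg, hg, neg_neg]; ring
  -- D5, D6, D7
  have hD5 : (weilPolarTerm (weilConv g (weilReflect g))).re ≤ 0 := by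
    rw [re_weilPolarTerm_weilConv_weilReflect_of_odd hgt hodd]
    nlinarith [norm_nonneg (weilMellin g 0)]
  have hE' : 0 ≤ E * Real.exp ((2 * P.m + 1) / ((k : ℝ) + 1)) := by positivity
  have hD6 := norm_weilPrimeTerm_oddTail_le (a := a + 1) hm2 hk hE' hTk0 hTkE hgt hsuppg hg hC hψ
  have hA' : ∫ x, ‖g x‖ ^ 2 ≤ A' := (integral_norm_sq_weilConv_moll_le hfc hfs k).trans hA
  have hB' : ∫ x, ‖deriv g x‖ ^ 2 ≤ B' := (integral_norm_sq_deriv_weilConv_moll_le hf1 hfs k).trans hB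
  have hD7' := ThetaArch.re_weilArchTerm_weilConv_weilReflect_le_thetaCheck hgt hA' hB' ht₀ ht₁
  have key : ∀ J L γ C : ℝ, 2 * J - (L + γ) - C = 2 * J - L - γ - C := fun _ _ _ _ ↦ by ring
  rw [key] at hD7'
  have hD7 : (weilArchTerm (weilConv g (weilReflect g))).re ≤ B' / 2 * Real.exp (t₀ / 2) * t₀ ^ 2 / 2 +
      A' * max 0 (2 * Jexplicit t₀ - Real.log (4 * π) - Real.eulerMascheroniConstant - archC₁) := by
    refine hD7'.trans (le_of_eq ?_)
    unfold Jexplicit archC₁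
    ring
  -- assemble
  have hre : (weilQuadratic g).re = (weilPolarTerm (weilConv g (weilReflect g))).re -
      (weilPrimeTerm (weilConv g (weilReflect g))).re + (weilArchTerm (weilConv g (weilReflect g))).re := by
    simp [weilQuadratic, weilFunctional]
  have hP6 : -(weilPrimeTerm (weilConv g (weilReflect g))).re ≤ ‖weilPrimeTerm (weilConv g (weilReflect g))‖ := by
    have := Complex.abs_re_le_norm (weilPrimeTerm (weilConv g (weilReflect g)))
    exact (neg_le_abs _).trans this
  rw [hre]
  linarith


/-- Sanity: at `A' = P.A`, `B' = P.B` the bracket IS `P.arch t₀`. -/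
theorem arch_eq_bracket (t₀ : ℝ) :
    P.arch t₀ = P.B / 2 * Real.exp (t₀ / 2) * t₀ ^ 2 / 2 +
      P.A * max 0 (2 * Jexplicit t₀ - Real.log (4 * π) - Real.eulerMascheroniConstant - archC₁) := rfl

end ThetaParams

end Summit.RiemannHypothesis.RiemannHypothesis.Theorems.WeilColumn.ThetaMellin

end
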